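import Summits.Ventures.PercRepro.PuncturedLYMSparsePaving
import Summits.Ventures.PercRepro.PuncturedLYMRestrict

/-!
# PercRepro — THE SPARSE-PAVING BRIDGE ON AN ARBITRARY GROUND SET: (NC) HOLDS FOR EVERY SPARSE PAVING MATROID ON
`n ≤ (3r + 1)/2` ELEMENTS (p10, gen 31)

PuncturedLYMSparsePaving proved the bridge for `gr M = univ`; with (SP) transferred to an arbitrary ground finset
(PuncturedLYMRestrict, `puncturedNMP_in_of_three_j`) the restriction disappears:
* `isCodeIn_cocode` — the co-code of a sparse paving matroid is a code inside `gr M`;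
* `biIndepSets_eq_puncturedIn`, `biIndepSets_succ_eq_powersetCard` — at the bottom level `j = n − r` (`n + 2 ≤ 2r`) the
  bi-independent `j`-sets are the punctured level inside `gr M` and every `(j+1)`-subset of `gr M` is bi-independent;
* **`normConsStep_bottom_of_puncturedNMPIn`** — the (NC) step at the bottom level follows from (SP) inside `gr M`;
* **`normConsAt_of_sparsePaving'`** — (NC) for every sparse paving matroid with `r + 1 ≤ n`, `n + 2 ≤ 2r`,
  `3(n − r) ≤ n + 1` — no assumption on the ground set.
Nothing here asserts (NC) or (SP) in general.
-/

open scoped Matroid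

namespace PercRepro.Cogirth

open Finset ThmH Skew

variable {α : Type} [DecidableEq α] {M : Matroid α} [M.Finite]

/-- **The co-code is a code inside the ground set** (`r ≤ n`). -/
theorem isCodeIn_cocode {r : ℕ} (hsp : IsSparsePavingF M r) (hr : r ≤ (gr M).card) :
    PuncturedLYM.IsCodeIn ((gr M).card - r) (gr M) (cocode M r) := by
  have h := isCode_cocode (α := α) hsp hr
  exact ⟨fun X hX => (mem_cocode.1 hX).1, h.2⟩

/-- The bi-independent `(n − r)`-sets are the punctured level inside `gr M` (`n + 2 ≤ 2r`). -/
theorem biIndepSets_eq_puncturedIn {r : ℕ} (hsp : IsSparsePavingF M r) (hn : (gr M).card + 2 ≤ 2 * r) :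
    biIndepSets M ((gr M).card - r) = PuncturedLYM.puncturedIn ((gr M).card - r) (gr M) (cocode M r) := by
  have hr : r ≤ (gr M).card := by
    have := hsp.1 ▸ rk_le_card (gr M)
    omega
  ext X
  rw [mem_biIndepSets, PuncturedLYM.puncturedIn, mem_sdiff, mem_powersetCard, mem_cocode]
  constructor
  · rintro ⟨hXg, hXc, -, hXd⟩
    refine ⟨⟨hXg, hXc⟩, ?_⟩
    rintro ⟨-, h⟩
    exact h hXd
  · rintro ⟨⟨hXg, hXc⟩, hXD⟩
    refine ⟨hXg, hXc, rk_eq_card_of_card_lt_of_sparsePaving hsp hr hXg (by omega), ?_⟩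
    by_contra h
    exact hXD ⟨⟨hXg, hXc⟩, h⟩

/-- The bi-independent `(n − r + 1)`-sets are all the `(n − r + 1)`-subsets of `gr M` (`n + 2 ≤ 2r`). -/
theorem biIndepSets_succ_eq_powersetCard {r : ℕ} (hsp : IsSparsePavingF M r) (hn : (gr M).card + 2 ≤ 2 * r) :
    biIndepSets M ((gr M).card - r + 1) = (gr M).powersetCard ((gr M).card - r + 1) := by
  have hr : r ≤ (gr M).card := by
    have := hsp.1 ▸ rk_le_card (gr M)
    omega
  apply biIndepSets_eq_powersetCard_of_indep_of_indep
  · intro S hS hSc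
    exact rk_eq_card_of_card_lt_of_sparsePaving hsp hr hS (by omega)
  · intro S hS hSc
    exact rk_eq_card_of_card_lt_of_sparsePaving hsp hr hS (by omega)

/-- **The bottom step of (NC) follows from (SP) inside the ground set** (`n + 2 ≤ 2r`). -/
theorem normConsStep_bottom_of_puncturedNMPIn {r : ℕ} (hsp : IsSparsePavingF M r)
    (hn : (gr M).card + 2 ≤ 2 * r) {U : Finset (Finset α)} (hU : UpFlats M U)
    (hSP : PuncturedLYM.PuncturedNMPIn ((gr M).card - r) (gr M) (cocode M r)) :
    NormConsStep M U ((gr M).card - r) := by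
  set j := (gr M).card - r with hj
  unfold NormConsStep upCount
  rw [biIndepSets_eq_puncturedIn hsp hn, biIndepSets_succ_eq_powersetCard hsp hn]
  set P := PuncturedLYM.puncturedIn j (gr M) (cocode M r) with hP
  set 𝒜 := P.filter (fun X => X ∈ U) with h𝒜
  have h𝒜P : 𝒜 ⊆ P := filter_subset _ _
  have hbot : P.filter (fun X => clF M X ∈ U) = 𝒜 := by
    apply filter_congr
    intro X hX
    rw [hP, PuncturedLYM.puncturedIn, mem_sdiff, mem_powersetCard] at hX
    rw [clF_eq_self_of_card_eq hsp hn hX.1.1 hX.1.2]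
  rw [hbot]
  have hup : PuncturedLYM.upNbhdIn j (gr M) 𝒜 ⊆ ((gr M).powersetCard (j + 1)).filter (fun Y => clF M Y ∈ U) := by
    intro Y hY
    rw [PuncturedLYM.upNbhdIn, mem_filter, mem_powersetCard] at hY
    obtain ⟨⟨hYg, hYc⟩, X, hX𝒜, hXY⟩ := hY
    rw [mem_filter, mem_powersetCard]
    refine ⟨⟨hYg, hYc⟩, ?_⟩
    have hXU : X ∈ U := (mem_filter.1 hX𝒜).2
    have hXcl : X ⊆ clF M Y := hXY.trans (subset_clF_fu hYg)
    exact hU.up X hXU (clF M Y) (isFlatF_clF Y) hXcl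
  have h1 := hSP 𝒜 h𝒜P
  have h2 := card_le_card hup
  rw [card_powersetCard]
  calc 𝒜.card * (gr M).card.choose (j + 1)
      ≤ (PuncturedLYM.upNbhdIn j (gr M) 𝒜).card * P.card := h1
    _ ≤ (((gr M).powersetCard (j + 1)).filter (fun Y => clF M Y ∈ U)).card * P.card :=
        Nat.mul_le_mul_right _ h2

/-- **(NC) HOLDS FOR EVERY SPARSE PAVING MATROID with `r + 1 ≤ n`, `n + 2 ≤ 2r` and `3(n − r) ≤ n + 1`** — on any
ground set (THEOREM A inside `gr M` at the bottom level, the Boolean and top steps of gen 29 elsewhere). -/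
theorem normConsAt_of_sparsePaving' {r : ℕ} (hsp : IsSparsePavingF M r) (hr1 : r + 1 ≤ (gr M).card)
    (hn : (gr M).card + 2 ≤ 2 * r) (h3 : 3 * ((gr M).card - r) ≤ (gr M).card + 1) : NormConsAt M := by
  intro U hU j
  have hr : r ≤ (gr M).card := by omega
  rcases Nat.lt_or_ge j ((gr M).card - r) with hlt | hge
  · apply normConsStep_of_lt
    rw [hsp.1]
    omega
  rcases Nat.eq_or_lt_of_le hge with heq | hgt
  · rw [← heq]
    apply normConsStep_bottom_of_puncturedNMPIn hsp hn hU
    exact PuncturedLYM.puncturedNMP_in_of_three_j (isCodeIn_cocode hsp hr) (by omega) (by omega) (by omega)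
  rcases Nat.lt_or_ge (j + 1) r with hmid | htop
  · apply normConsStep_of_indep_succ_of_indep_sdiff hU (by omega)
    · intro S hS hSc
      exact rk_eq_card_of_card_lt_of_sparsePaving hsp hr hS (by omega)
    · intro S hS hSc
      exact rk_eq_card_of_card_lt_of_sparsePaving hsp hr hS (by omega)
  · apply normConsStep_of_rk_le hU
    rw [hsp.1]
    omega

end PercRepro.Cogirth
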